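import Summits.AtomisticToContinuum.HydrodynamicLimit.Theorems.JParityClosureLocalSecondLawContactDefs
import Summits.AtomisticToContinuum.HydrodynamicLimit.Theorems.JParityClosureLocalSecondLawContactHistoryNet
import Summits.AtomisticToContinuum.HydrodynamicLimit.Theorems.JParityClosureLocalSecondLawRegularRangeTools
import Summits.AtomisticToContinuum.HydrodynamicLimit.Theorems.JParityClosureLocalSecondLawCoarseFieldBounds
import Summits.AtomisticToContinuum.HydrodynamicLimit.Theorems.JParityClosureDensityCapMeanDisplacement
import Literature.MathematicalPhysics.KineticTheory.HardSphereEulerProofs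

/-!
# Stub T (`stub_historyNet`) of the line `contact-asymmetry-information` reduced to an oscillation modulus of the
coarse momentum and kinetic-energy histories (crux `JParityClosure.LocalSecondLaw`, stmt-AtomisticToContinuum-13081;
registered sub-lemmas `contactT_historyNet_of_oscillation`, `contact_historyNet_of_oscillationModulus`)

Stub T asks, for `σ < σ₀(profiles)`, every flow family, horizon `τ`, resolution `η′`, tolerance `δ′` and radius `r`,
for an `N`-INDEPENDENT number `M` of coarse history centres `c_j : ℝ → 𝕋³ → ℝ × V3 × ℝ` such that, eventually in `N`,
all but `δ′` of the local-Gibbs mass is PINNED (`Pin`: `|ρ_r − c.1|, ‖m_r − c.2.1‖, |e_r − c.2.2| ≤ η′` on all of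
`[0, τ] × 𝕋³` along the orbit) to one of them.  The density part is landed unconditionally
(`Theorems/JParityClosureLocalSecondLawContactHistoryNet.lean`, `contactT_densityHistoryNet`).  Here the FULL
conclusion of T is derived, for `σ ≤ 1/2`, from ONE a-priori input stated inline: an OSCILLATION MODULUS IN
PROBABILITY of `(m_r, e_r)` — for all `κ, δ″ > 0` a window `h > 0` with, eventually in `N`,
`P_N(∃ s, s′ ∈ [0,τ], |s − s′| ≤ h, ∃ x : ‖m_r(Φₛz)(x) − m_r(Φ_{s′}z)(x)‖ > κ ∨ |e_r(Φₛz)(x) − e_r(Φ_{s′}z)(x)| > κ) ≤ δ″`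
(`contactT_historyNet_of_oscillation`); and the registered text of T follows verbatim from the stub-shaped (profiles /
`σ₀` / flows / horizon) form of that modulus (`contact_historyNet_of_oscillationModulus`).  Why this is the right cut:
`ρ_r` has an a-priori Lipschitz clock (positions move continuously with the velocities; `gridUp_clock`,
`stub_meanDisplacement`), but `m_r`, `e_r` JUMP at collisions by `(N+1)⁻¹(b_r(xᵢ,·) − b_r(xⱼ,·))Δvᵢ = O(ε|Δvᵢ|/((N+1)r⁴))`;
individually negligible, their accumulation over a short window is the normalised collision activity
`(ε/(N+1))∑|g·ω|`, which admits NO pathwise bound (momentum travels arbitrarily fast along nearly-touching rows of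
spheres) and whose control in probability along the non-stationary local-Gibbs dynamics is not in the tree (the
total-count tightness `CollisionTightness`, stmt-13085, is open off equilibrium); for `e_r` the free-streaming part
moreover involves the empirical cubic velocity moment along the flow.  Given the modulus, the net is explicit: on the
good set with energy per particle `≤ K` (energy tightness `densityNet_energyTight`, conservation `ke_flow_eq`) the
three fields are Lipschitz in the centre (`gridUp_abs_mollDensity_sub_le_centre`, `rr_norm_momC_sub_le_centre`,
`rr_abs_kinC_sub_le_centre`) and bounded (`mollDensity_le`, `norm_momC_le`, `e_r ≤ 3ke/(πr³)`), so rounding the values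
at a finite space–time net (`gridUp_euclidNet`, `gridUp_timeNet`) to a grid of levels / a finite net of the momentum
ball (`finite_cover_balls_of_compact`) gives piecewise-constant centres, `M = (levels × momentum net × levels)^(net)`;
the bad set is law-null (`gridUp_localGibbsLaw_compl_good`).

References: C. Kipnis, C. Landim, *Scaling Limits of Interacting Particle Systems* (1999), Ch. 4 (tightness in path
space through moduli of continuity); P. Billingsley, *Convergence of Probability Measures* (2nd ed., 1999), Thm. 7.3
(Arzelà–Ascoli tightness criterion); H. Spohn, *Large Scale Dynamics of Interacting Particles* (1991), Part I §3.
-/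

noncomputable section

open scoped BigOperators Topology Classical MeasureTheory ENNReal InnerProductSpace
open Filter Set MeasureTheory Function
open Literature.MathematicalPhysics.KineticTheory
open Literature.Analysis.FluidPDE
open Summit.AtomisticToContinuum.HydrodynamicLimit.Theorems.LocalSecondLawNegative
open Summit.AtomisticToContinuum.HydrodynamicLimit.Theorems.LocalSecondLawLedger

namespace Summit.AtomisticToContinuum.HydrodynamicLimit.Theorems.LocalSecondLawContact

/-- `e_r ≤ (3/(πr³)) · ke` (the cone kernel is at most its peak value). -/
private theorem oscRed_kinC_le {N : ℕ} {r : ℝ} (hr : 0 < r) (w : Phase N) (x₀ : T3) :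
    kinC r w x₀ ≤ 3 / (Real.pi * r ^ 3) * ke w := by
  rw [kinC_eq_sum]
  unfold ke
  calc ((N + 1 : ℕ) : ℝ)⁻¹ * ∑ i, cone r (w i).1 x₀ * (‖(w i).2‖ ^ 2 / 2)
      ≤ ((N + 1 : ℕ) : ℝ)⁻¹ * ∑ i, 3 / (Real.pi * r ^ 3) * (‖(w i).2‖ ^ 2 / 2) := by
        gcongr with i _
        exact cone_le_const hr _ _
    _ = 3 / (Real.pi * r ^ 3) * (((N + 1 : ℕ) : ℝ)⁻¹ * ∑ i, ‖(w i).2‖ ^ 2 / 2) := by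
        rw [← Finset.mul_sum]
        ring

/-- **T reduced · `contactT_historyNet_of_oscillation`.**  Stub T (`stub_historyNet`: an `N`-independent finite
`η′`-net of the coarse histories `s ↦ (ρ_r, m_r, e_r)(Φₛz)` in sup-norm on `[0,τ] × 𝕋³`, outside local-Gibbs mass
`δ′`, eventually in `N`) FOLLOWS, for `σ ≤ 1/2`, from ONE a-priori input: an OSCILLATION MODULUS IN PROBABILITY of the
coarse momentum and kinetic-energy histories — for every `κ, δ″ > 0` a window `h > 0` such that, eventually in `N`,
with probability `≥ 1 − δ″` the fields `m_r(Φₛz)(x)`, `e_r(Φₛz)(x)` oscillate by at most `κ` over all time pairs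
`s, s′ ∈ [0, τ]` with `|s − s′| ≤ h` and all `x` (asymptotic equicontinuity; the collision jumps
`(N+1)⁻¹(b_r(xᵢ,·) − b_r(xⱼ,·))Δvᵢ = O(ε |Δvᵢ| /((N+1) r⁴))` are individually negligible, their accumulation over
short windows is what the hypothesis controls).  Everything else is in the tree: energy tightness under the local
Gibbs law (`densityNet_energyTight`), the centre-Lipschitz bounds of `ρ_r, m_r, e_r` (`gridUp_abs_mollDensity_sub_le_centre`,
`rr_norm_momC_sub_le_centre`, `rr_abs_kinC_sub_le_centre`), the Lipschitz clock of `ρ_r` (`gridUp_clock`,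
`stub_meanDisplacement`), sup bounds (`mollDensity_le`, `norm_momC_le`, `oscRed_kinC_le`), finite nets of `𝕋³`,
`[0,τ]` (`gridUp_euclidNet`, `gridUp_timeNet`) and of the momentum ball (`finite_cover_balls_of_compact`), energy
conservation (`ke_flow_eq`) and nullity of the bad set (`gridUp_localGibbsLaw_compl_good`); the net is the explicit
family of piecewise-constant centres obtained by rounding grid values (`M = (levels × momentum net × levels)^(net)`). -/
theorem contactT_historyNet_of_oscillation : ∀ (a₀ θ₀ : T3 → ℝ) (u₀ : T3 → V3), Continuous a₀ → Continuous θ₀ → Continuous u₀ → (∀ x, 0 < a₀ x) → (∀ x, 0 < θ₀ x) → ∀ σ : ℝ, 0 < σ → σ ≤ 1 / 2 → ∀ Φ : (N : ℕ) → Flow σ N, ∀ τ : ℝ, 0 < τ → ∀ η' δ' : ℝ, 0 < η' → 0 < δ' → ∀ r : ℝ, 0 < r → (∀ κ δ'' : ℝ, 0 < κ → 0 < δ'' → ∃ h : ℝ, 0 < h ∧ ∃ N₁ : ℕ, ∀ N : ℕ, N₁ ≤ N → localGibbsLaw σ a₀ u₀ θ₀ N (Φ N) {z | ∃ s ∈ Set.Icc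 (0 : ℝ) τ, ∃ s' ∈ Set.Icc (0 : ℝ) τ, |s - s'| ≤ h ∧ ∃ x : T3, κ < ‖momC r ((Φ N).flow s z) x - momC r ((Φ N).flow s' z) x‖ ∨ κ < |kinC r ((Φ N).flow s z) x - kinC r ((Φ N).flow s' z) x|} ≤ ENNReal.ofReal δ'') → ∃ M : ℕ, 0 < M ∧ ∃ N₀ : ℕ, ∀ N : ℕ, N₀ ≤ N → ∃ c : Fin M → Centre, localGibbsLaw σ a₀ u₀ θ₀ N (Φ N) {z | ∀ j : Fin M, z ∉ Pin σ r τ η' (Φ N) (c j)} ≤ ENNReal.ofReal δ' := by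
  intro a₀ θ₀ u₀ ha hθ hu ha0 hθ0 σ _hσ hσ2 Φ τ hτ η' δ' hη' hδ' r hr hosc
  -- energy tightness under the local Gibbs law
  obtain ⟨K, hK0, hK⟩ := densityNet_energyTight ha hθ hu ha0 hθ0 hσ2 Φ
  have hδ2 : 0 < δ' / 2 := by positivity
  -- the resolution of every link
  set q : ℝ := η' / 4 with hqdef
  have hq : 0 < q := by positivity
  -- the oscillation modulus at level `q`, mass `δ'/2`
  obtain ⟨h, hh, N₁, hN₁⟩ := hosc q (δ' / 2) hq hδ2
  -- constants at fixed `r`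
  set L : ℝ := 3 / (Real.pi * r ^ 4) with hLdef
  have hL : 0 < L := by positivity
  set V : ℝ := Real.sqrt (2 * K) with hVdef
  have hV : 0 ≤ V := Real.sqrt_nonneg _
  set Ka : ℝ := K + 1 with hKadef
  have hKa1 : 1 ≤ Ka := by rw [hKadef]; linarith
  have hKa : 0 < Ka := by positivity
  set δx : ℝ := q / (L * Ka) with hδxdef
  have hδx : 0 < δx := by positivity
  have hδx' : L * Ka * δx = q := by rw [hδxdef]; field_simp
  set δt : ℝ := min h (q / (L * (V + 1))) with hδtdef
  have hδt : 0 < δt := lt_min hh (by positivity)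
  have hδth : δt ≤ h := min_le_left _ _
  have hδt' : L * V * δt ≤ q := by
    calc L * V * δt ≤ L * (V + 1) * (q / (L * (V + 1))) :=
          mul_le_mul (by gcongr; linarith) (min_le_right _ _) hδt.le (by positivity)
      _ = q := by field_simp
  set Bm : ℝ := 3 / (Real.pi * r ^ 3) * Ka with hBmdef
  have hBm : 0 ≤ Bm := by positivity
  have hC3 : 0 ≤ 3 / (Real.pi * r ^ 3) := by positivity
  -- finite nets of `𝕋³`, of `[0, τ]` and of the momentum ball
  obtain ⟨Sx, hSx⟩ := gridUp_euclidNet hδx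
  obtain ⟨St, hSt, hSt'⟩ := gridUp_timeNet τ hδt
  obtain ⟨Tm, -, hTmfin, hTmcov⟩ :=
    finite_cover_balls_of_compact (isCompact_closedBall (0 : V3) Bm) (e := q) hq
  have hτ0 : (0 : ℝ) ∈ Set.Icc (0 : ℝ) τ := ⟨le_rfl, hτ.le⟩
  obtain ⟨k₀, hk₀, -⟩ := hSt' 0 hτ0
  have hcovM : ∀ m : V3, ‖m‖ ≤ Bm → ∃ p ∈ Tm, ‖m - p‖ < q := by
    intro m hm
    have hmB : m ∈ Metric.closedBall (0 : V3) Bm := mem_closedBall_zero_iff.2 hm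
    have := hTmcov hmB
    simp only [Set.mem_iUnion, exists_prop] at this
    obtain ⟨p, hp, hmp⟩ := this
    exact ⟨p, hp, mem_ball_iff_norm.1 hmp⟩
  obtain ⟨p₀, hp₀, -⟩ := hcovM 0 (by rw [norm_zero]; exact hBm)
  -- selectors of a net time / net point / net momentum
  have hselT : ∀ s : ℝ, ∃ k : St, s ∈ Set.Icc (0 : ℝ) τ → |s - (k : ℝ)| ≤ δt := by
    intro s
    by_cases hs : s ∈ Set.Icc (0 : ℝ) τ
    · obtain ⟨k, hk, hsk⟩ := hSt' s hs
      exact ⟨⟨k, hk⟩, fun _ => hsk⟩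
    · exact ⟨⟨k₀, hk₀⟩, fun h => absurd h hs⟩
  choose kSel hkSel using hselT
  have hselX : ∀ x : T3, ∃ l : Sx, Torus.euclidDist x (l : T3) ≤ δx := by
    intro x
    obtain ⟨l, hl, hxl⟩ := hSx x
    exact ⟨⟨l, hl⟩, hxl⟩
  choose lSel hlSel using hselX
  have hselM : ∀ m : V3, ∃ p : hTmfin.toFinset, ‖m‖ ≤ Bm → ‖m - (p : V3)‖ ≤ q := by
    intro m
    by_cases hm : ‖m‖ ≤ Bm
    · obtain ⟨p, hp, hmp⟩ := hcovM m hm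
      exact ⟨⟨p, hTmfin.mem_toFinset.2 hp⟩, fun _ => hmp.le⟩
    · exact ⟨⟨p₀, hTmfin.mem_toFinset.2 hp₀⟩, fun h => absurd h hm⟩
  choose mSel hmSel using hselM
  haveI : Nonempty hTmfin.toFinset := ⟨⟨p₀, hTmfin.mem_toFinset.2 hp₀⟩⟩
  -- quantisation levels and the finite family of centres
  set Nv : ℕ := ⌈Bm / q⌉₊ with hNvdef
  have hMpos : 0 < Fintype.card (St × Sx → Fin (Nv + 1) × hTmfin.toFinset × Fin (Nv + 1)) := Fintype.card_pos
  -- `N₀` from the energy tail and from the oscillation modulus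
  have hev : ∀ᶠ N in atTop, localGibbsLaw σ a₀ u₀ θ₀ N (Φ N)
      {z | K < ((N + 1 : ℕ) : ℝ)⁻¹ * configEnergy z} < ENNReal.ofReal (δ' / 2) :=
    (tendsto_order.1 hK).2 _ (ENNReal.ofReal_pos.2 hδ2)
  obtain ⟨N₂, hN₂⟩ := eventually_atTop.1 hev
  refine ⟨Fintype.card (St × Sx → Fin (Nv + 1) × hTmfin.toFinset × Fin (Nv + 1)), hMpos, max N₁ N₂, fun N hN => ?_⟩
  have hNN₁ : N₁ ≤ N := (le_max_left _ _).trans hN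
  have hNN₂ : N₂ ≤ N := (le_max_right _ _).trans hN
  set e := Fintype.equivFin (St × Sx → Fin (Nv + 1) × hTmfin.toFinset × Fin (Nv + 1)) with hedef
  -- the centres: rounded grid values, piecewise constant on the cells of the space–time net
  refine ⟨fun j s x => ((((e.symm j (kSel s, lSel x)).1 : ℕ) : ℝ) * q, ((e.symm j (kSel s, lSel x)).2.1 : V3),
    (((e.symm j (kSel s, lSel x)).2.2 : ℕ) : ℝ) * q), ?_⟩
  -- the oscillation event
  set Osc : Set (Phase N) := {z | ∃ s ∈ Set.Icc (0 : ℝ) τ, ∃ s' ∈ Set.Icc (0 : ℝ) τ, |s - s'| ≤ h ∧ ∃ x : T3,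
      q < ‖momC r ((Φ N).flow s z) x - momC r ((Φ N).flow s' z) x‖ ∨
        q < |kinC r ((Φ N).flow s z) x - kinC r ((Φ N).flow s' z) x|} with hOscdef
  -- a generic rounding estimate
  have hround : ∀ v : ℝ, 0 ≤ v → v ≤ Bm →
      min ⌊v / q⌋₊ Nv = ⌊v / q⌋₊ ∧ |v - (⌊v / q⌋₊ : ℝ) * q| ≤ q := by
    intro v hv0 hv1
    have hfloor_le : ⌊v / q⌋₊ ≤ Nv :=
      (Nat.floor_le_ceil _).trans (Nat.ceil_mono (div_le_div_of_nonneg_right hv1 hq.le))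
    refine ⟨min_eq_left hfloor_le, ?_⟩
    have hfl : (⌊v / q⌋₊ : ℝ) ≤ v / q := Nat.floor_le (div_nonneg hv0 hq.le)
    have hfl' : v / q < ⌊v / q⌋₊ + 1 := Nat.lt_floor_add_one _
    have hlo : (⌊v / q⌋₊ : ℝ) * q ≤ v := by
      have := mul_le_mul_of_nonneg_right hfl hq.le
      rwa [div_mul_cancel₀ _ hq.ne'] at this
    have hhi : v < ((⌊v / q⌋₊ : ℝ) + 1) * q := by
      have := mul_lt_mul_of_pos_right hfl' hq
      rwa [div_mul_cancel₀ _ hq.ne'] at this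
    rw [abs_le]
    constructor <;> nlinarith
  -- the sure inclusion
  have hsub : {z : Phase N | ∀ j : Fin (Fintype.card (St × Sx → Fin (Nv + 1) × hTmfin.toFinset × Fin (Nv + 1))),
        z ∉ Pin σ r τ η' (Φ N) (fun s x => ((((e.symm j (kSel s, lSel x)).1 : ℕ) : ℝ) * q,
          ((e.symm j (kSel s, lSel x)).2.1 : V3), (((e.symm j (kSel s, lSel x)).2.2 : ℕ) : ℝ) * q))}
      ⊆ ((Φ N).goodᶜ ∪ {z | K < ((N + 1 : ℕ) : ℝ)⁻¹ * configEnergy z}) ∪ Osc := by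
    intro z hz
    by_cases hg : z ∈ (Φ N).good
    swap
    · exact Or.inl (Or.inl hg)
    by_cases hKz : ((N + 1 : ℕ) : ℝ)⁻¹ * configEnergy z ≤ K
    swap
    · exact Or.inl (Or.inr (not_le.1 hKz))
    by_cases hOz : z ∈ Osc
    · exact Or.inr hOz
    exfalso
    -- the modulus of `(m_r, e_r)` along the orbit of `z`
    have hmod : ∀ s ∈ Set.Icc (0 : ℝ) τ, ∀ s' ∈ Set.Icc (0 : ℝ) τ, |s - s'| ≤ h → ∀ x : T3,
        ‖momC r ((Φ N).flow s z) x - momC r ((Φ N).flow s' z) x‖ ≤ q ∧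
          |kinC r ((Φ N).flow s z) x - kinC r ((Φ N).flow s' z) x| ≤ q := by
      intro s hs s' hs' hss' x
      by_contra hcon
      apply hOz
      refine ⟨s, hs, s', hs', hss', x, ?_⟩
      rcases not_and_or.1 hcon with h1 | h1
      · exact Or.inl (not_le.1 h1)
      · exact Or.inr (not_le.1 h1)
    -- energy along the orbit
    have hkeE : ∀ s, ke ((Φ N).flow s z) ≤ K := fun s => by
      rw [ke_flow_eq (Φ N) hg s, rr_ke_eq]; exact hKz
    have hke0 : ∀ s, 0 ≤ ke ((Φ N).flow s z) := fun s => ke_nonneg _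
    -- the rounding of `z`'s own grid values
    let g : St × Sx → Fin (Nv + 1) × hTmfin.toFinset × Fin (Nv + 1) := fun p =>
      (⟨min ⌊rhoC r ((Φ N).flow (p.1 : ℝ) z) (p.2 : T3) / q⌋₊ Nv, Nat.lt_succ_of_le (min_le_right _ _)⟩,
        mSel (momC r ((Φ N).flow (p.1 : ℝ) z) (p.2 : T3)),
        ⟨min ⌊kinC r ((Φ N).flow (p.1 : ℝ) z) (p.2 : T3) / q⌋₊ Nv, Nat.lt_succ_of_le (min_le_right _ _)⟩)
    have hfar := hz (e g)
    rw [e.symm_apply_apply] at hfar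
    apply hfar
    -- `z` is pinned by its own rounded centre
    intro s hs x
    have hsk : |s - (kSel s : ℝ)| ≤ δt := hkSel s hs
    have hxl : Torus.euclidDist x (lSel x : T3) ≤ δx := hlSel x
    set k : ℝ := (kSel s : ℝ) with hkdef
    have hkI : k ∈ Set.Icc (0 : ℝ) τ := hSt _ (kSel s).2
    set l : T3 := (lSel x : T3) with hldef
    set w : Phase N := (Φ N).flow s z with hwdef
    set wk : Phase N := (Φ N).flow k z with hwkdef
    have hd0 : 0 ≤ Torus.euclidDist x l := by rw [Torus.euclidDist_eq]; positivity
    have hLd : L * Torus.euclidDist x l * Ka ≤ q := by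
      calc L * Torus.euclidDist x l * Ka ≤ L * δx * Ka := by gcongr
        _ = q := by rw [← hδx']; ring
    obtain ⟨hm2, he2⟩ := hmod s hs k hkI (hsk.trans hδth) l
    -- density
    have h1ρ : |rhoC r w x - rhoC r w l| ≤ q := by
      have h : |rhoC r w x - rhoC r w l| ≤ 3 / (Real.pi * r ^ 4) * Torus.euclidDist x l :=
        gridUp_abs_mollDensity_sub_le_centre hr w x l
      calc |rhoC r w x - rhoC r w l| ≤ L * Torus.euclidDist x l * 1 := by rw [mul_one]; exact h
        _ ≤ L * Torus.euclidDist x l * Ka := by gcongr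
        _ ≤ q := hLd
    have h2ρ : |rhoC r w l - rhoC r wk l| ≤ q := by
      have hclock : |rhoC r w l - rhoC r wk l| ≤
          3 / (Real.pi * r ^ 4) * Real.sqrt (2 * (((N + 1 : ℕ) : ℝ)⁻¹ * configEnergy z)) * |s - k| :=
        gridUp_clock hr (Φ N) (stub_meanDisplacement (Φ N) hg) k s l
      exact hclock.trans ((capSub_clock_mono hL.le hKz hsk).trans hδt')
    have hρ0 : 0 ≤ rhoC r wk l := DensityCapNegative.mollDensity_nonneg hr wk l
    have hρ1 : rhoC r wk l ≤ Bm := by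
      have h : rhoC r wk l ≤ 3 / (Real.pi * r ^ 3) := DensityCapNegative.mollDensity_le hr wk l
      calc rhoC r wk l ≤ 3 / (Real.pi * r ^ 3) * 1 := by rw [mul_one]; exact h
        _ ≤ Bm := by rw [hBmdef]; gcongr
    obtain ⟨hgρ, h3ρ⟩ := hround _ hρ0 hρ1
    -- momentum
    have h1m : ‖momC r w x - momC r w l‖ ≤ q := by
      have h : ‖momC r w x - momC r w l‖ ≤ 3 / (Real.pi * r ^ 4) * Torus.euclidDist x l * (1 / 2 + ke w) :=
        rr_norm_momC_sub_le_centre hr w x l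
      calc ‖momC r w x - momC r w l‖ ≤ L * Torus.euclidDist x l * (1 / 2 + ke w) := h
        _ ≤ L * Torus.euclidDist x l * Ka := by
            refine mul_le_mul_of_nonneg_left ?_ (by positivity)
            rw [hKadef]; linarith [hkeE s]
        _ ≤ q := hLd
    have hmB : ‖momC r wk l‖ ≤ Bm := by
      calc ‖momC r wk l‖ ≤ 3 / (Real.pi * r ^ 3) * (1 / 2 + ke wk) := norm_momC_le hr wk l
        _ ≤ 3 / (Real.pi * r ^ 3) * Ka := by
            refine mul_le_mul_of_nonneg_left ?_ hC3
            rw [hKadef]; linarith [hkeE k]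
    have h3m : ‖momC r wk l - (mSel (momC r wk l) : V3)‖ ≤ q := hmSel _ hmB
    -- kinetic energy
    have h1e : |kinC r w x - kinC r w l| ≤ q := by
      have h : |kinC r w x - kinC r w l| ≤ 3 / (Real.pi * r ^ 4) * Torus.euclidDist x l * ke w :=
        rr_abs_kinC_sub_le_centre hr w x l
      calc |kinC r w x - kinC r w l| ≤ L * Torus.euclidDist x l * ke w := h
        _ ≤ L * Torus.euclidDist x l * Ka := by
            refine mul_le_mul_of_nonneg_left ?_ (by positivity)
            rw [hKadef]; linarith [hkeE s]
        _ ≤ q := hLd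
    have he0 : 0 ≤ kinC r wk l := kinC_nonneg hr wk l
    have he1 : kinC r wk l ≤ Bm := by
      calc kinC r wk l ≤ 3 / (Real.pi * r ^ 3) * ke wk := oscRed_kinC_le hr wk l
        _ ≤ 3 / (Real.pi * r ^ 3) * Ka := by
            refine mul_le_mul_of_nonneg_left ?_ hC3
            rw [hKadef]; linarith [hkeE k]
    obtain ⟨hge, h3e⟩ := hround _ he0 he1
    -- the values of the own centre at `(s, x)`
    have hg1 : (((g (kSel s, lSel x)).1 : ℕ) : ℝ) = (⌊rhoC r wk l / q⌋₊ : ℝ) := by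
      show ((min ⌊rhoC r wk l / q⌋₊ Nv : ℕ) : ℝ) = _
      rw [hgρ]
    have hg2 : ((g (kSel s, lSel x)).2.1 : V3) = (mSel (momC r wk l) : V3) := rfl
    have hg3 : (((g (kSel s, lSel x)).2.2 : ℕ) : ℝ) = (⌊kinC r wk l / q⌋₊ : ℝ) := by
      show ((min ⌊kinC r wk l / q⌋₊ Nv : ℕ) : ℝ) = _
      rw [hge]
    have hq3 : q + q + q ≤ η' := by rw [hqdef]; linarith
    refine ⟨?_, ?_, ?_⟩
    · show |rhoC r w x - (((g (kSel s, lSel x)).1 : ℕ) : ℝ) * q| ≤ η'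
      rw [hg1]
      have t1 := abs_sub_le (rhoC r w x) (rhoC r w l) ((⌊rhoC r wk l / q⌋₊ : ℝ) * q)
      have t2 := abs_sub_le (rhoC r w l) (rhoC r wk l) ((⌊rhoC r wk l / q⌋₊ : ℝ) * q)
      linarith
    · show ‖momC r w x - ((g (kSel s, lSel x)).2.1 : V3)‖ ≤ η'
      rw [hg2]
      have t1 := norm_sub_le_norm_sub_add_norm_sub (momC r w x) (momC r w l) (mSel (momC r wk l) : V3)
      have t2 := norm_sub_le_norm_sub_add_norm_sub (momC r w l) (momC r wk l) (mSel (momC r wk l) : V3)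
      linarith
    · show |kinC r w x - (((g (kSel s, lSel x)).2.2 : ℕ) : ℝ) * q| ≤ η'
      rw [hg3]
      have t1 := abs_sub_le (kinC r w x) (kinC r w l) ((⌊kinC r wk l / q⌋₊ : ℝ) * q)
      have t2 := abs_sub_le (kinC r w l) (kinC r wk l) ((⌊kinC r wk l / q⌋₊ : ℝ) * q)
      linarith
  -- the measure bound
  have hδhalf : ENNReal.ofReal (δ' / 2) + ENNReal.ofReal (δ' / 2) = ENNReal.ofReal δ' := by
    rw [← ENNReal.ofReal_add hδ2.le hδ2.le, add_halves]
  calc localGibbsLaw σ a₀ u₀ θ₀ N (Φ N) {z : Phase N | ∀ j : Fin (Fintype.card (St × Sx → Fin (Nv + 1) × hTmfin.toFinset × Fin (Nv + 1))),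
        z ∉ Pin σ r τ η' (Φ N) (fun s x => ((((e.symm j (kSel s, lSel x)).1 : ℕ) : ℝ) * q,
          ((e.symm j (kSel s, lSel x)).2.1 : V3), (((e.symm j (kSel s, lSel x)).2.2 : ℕ) : ℝ) * q))}
      ≤ localGibbsLaw σ a₀ u₀ θ₀ N (Φ N) (((Φ N).goodᶜ ∪ {z | K < ((N + 1 : ℕ) : ℝ)⁻¹ * configEnergy z}) ∪ Osc) :=
        measure_mono hsub
    _ ≤ localGibbsLaw σ a₀ u₀ θ₀ N (Φ N) (Φ N).goodᶜ +
          localGibbsLaw σ a₀ u₀ θ₀ N (Φ N) {z | K < ((N + 1 : ℕ) : ℝ)⁻¹ * configEnergy z} +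
            localGibbsLaw σ a₀ u₀ θ₀ N (Φ N) Osc :=
        (measure_union_le _ _).trans (add_le_add (measure_union_le _ _) le_rfl)
    _ ≤ 0 + ENNReal.ofReal (δ' / 2) + ENNReal.ofReal (δ' / 2) :=
        add_le_add (add_le_add (le_of_eq (gridUp_localGibbsLaw_compl_good σ a₀ θ₀ u₀ N (Φ N))) (hN₂ N hNN₂).le)
          (hN₁ N hNN₁)
    _ = ENNReal.ofReal δ' := by rw [zero_add, hδhalf]

/-- **Stub T from the oscillation-modulus statement** (`contact_historyNet_of_oscillationModulus`): the registered
expanded text of stub T (`contact_historyNet`) follows VERBATIM from the stub-shaped oscillation modulus of the coarse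
momentum and kinetic-energy histories (same profile/`σ₀`/flow/horizon frame; `σ₀` is cut down to `≤ 1/2` so that the
local Gibbs laws are probability measures), by `contactT_historyNet_of_oscillation`.  This isolates the single missing
a-priori input of stub T. -/
theorem contact_historyNet_of_oscillationModulus : (∀ (a₀ θ₀ : T3 → ℝ) (u₀ : T3 → V3), Continuous a₀ → Continuous θ₀ → Continuous u₀ → (∀ x, 0 < a₀ x) → (∀ x, 0 < θ₀ x) → ∃ σ₀ : ℝ, 0 < σ₀ ∧ ∀ σ : ℝ, 0 < σ → σ < σ₀ → ∀ Φ : (N : ℕ) → Flow σ N, ∀ τ : ℝ, 0 < τ → ∀ κ δ'' : ℝ, 0 < κ → 0 < δ'' → ∀ r : ℝ, 0 < r → ∃ h : ℝ, 0 < h ∧ ∃ N₁ : ℕ, ∀ N : ℕ, N₁ ≤ N → localGibbsLaw σ a₀ u₀ θ₀ N (Φ N) {z | ∃ s ∈ Set.Icc (0 : ℝ) τ, ∃ s' ∈ Set.Icc (0 : ℝ) τ, |s - s'| ≤ h ∧ ∃ x : T3, κ < ‖momC r ((Φ N).flow s z) x - momC r ((Φ N).flow s' z) x‖ ∨ κ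 < |kinC r ((Φ N).flow s z) x - kinC r ((Φ N).flow s' z) x|} ≤ ENNReal.ofReal δ'') → ∀ (a₀ θ₀ : T3 → ℝ) (u₀ : T3 → V3), Continuous a₀ → Continuous θ₀ → Continuous u₀ → (∀ x, 0 < a₀ x) → (∀ x, 0 < θ₀ x) → ∃ σ₀ : ℝ, 0 < σ₀ ∧ ∀ σ : ℝ, 0 < σ → σ < σ₀ → ∀ Φ : (N : ℕ) → Flow σ N, ∀ τ : ℝ, 0 < τ → ∀ η' δ' : ℝ, 0 < η' → 0 < δ' → ∀ r : ℝ, 0 < r → ∃ M : ℕ, 0 < M ∧ ∃ N₀ : ℕ, ∀ N : ℕ, N₀ ≤ N → ∃ c : Fin M → Centre, localGibbsLaw σ a₀ u₀ θ₀ N (Φ N) {z | ∀ j : Fin M, z ∉ Pin σ r τ η' (Φ N) (c j)} ≤ ENNReal.ofReal δ' := by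
  intro hOsc a₀ θ₀ u₀ ha hθ hu ha0 hθ0
  obtain ⟨σ₀, hσ₀, hO⟩ := hOsc a₀ θ₀ u₀ ha hθ hu ha0 hθ0
  refine ⟨min σ₀ (1 / 2), lt_min hσ₀ (by norm_num), fun σ hσ hσlt Φ τ hτ η' δ' hη' hδ' r hr => ?_⟩
  have hσ₀' : σ < σ₀ := hσlt.trans_le (min_le_left _ _)
  have hσ2 : σ ≤ 1 / 2 := (hσlt.trans_le (min_le_right _ _)).le
  exact contactT_historyNet_of_oscillation a₀ θ₀ u₀ ha hθ hu ha0 hθ0 σ hσ hσ2 Φ τ hτ η' δ' hη' hδ' r hr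
    (fun κ δ'' hκ hδ'' => hO σ hσ hσ₀' Φ τ hτ κ δ'' hκ hδ'' r hr)

end Summit.AtomisticToContinuum.HydrodynamicLimit.Theorems.LocalSecondLawContact

end
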